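import Summits.BirchSwinnertonDyer.BirchSwinnertonDyer.Theses.TameQuarticManinParity
import Literature.NumberTheory.ModularSymbols.CuspidalHomologyPrymDefect
import Literature.NumberTheory.EllipticCurves.AlgebraicModularParametrizationWithShift
import Literature.NumberTheory.GaloisRepresentations.IntegralGaloisActionProofs
import HarnessLib
import Literature.NumberTheory.EllipticCurves.ModularJacobianShiftFixedFrobenius

/-!
# Route `TameQuarticManinParity`, stub E30 `PrymDefectHeckeEisensteinSplit` (stmt-BirchSwinnertonDyer-23597) from
# ONE named fact: the `ℚ`-structure of `J₀(N)` with shift, Eichler–Shimura on `J₀(N)[3]`, and the triviality of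
# `Frob_p`, `p ≡ 1 (mod N)`, on `π₀(J₀(N)^t) = J₀(N)^t / Nm J₀(N)`

Lead seat `cruxlead-stmt-BirchSwinnertonDyer-23367` g0, line `abelian-fixed-points`. E30 is the W-free level
statement «`T_p ≡ 2` on the Hilbert-90 defect `Λ_P/Λ₁` for `p ≡ 1 (mod N)`» (pen bsd-idea-3 g9, LINE 30). This file
proves it CONDITIONALLY on the named fact `nonempty_shiftDatumEichlerShimuraFixedFrobenius` (stated inline here for
the gate to relocate under `Literature/`), using the landed lattice dictionary `prymDefectMap`
(`CuspidalHomologyPrymDefect`, p673397): `δ(y) = [3⁻¹(y − t y)] ∈ J₀(N)^t_tors`, kernel modulo `B = Nm J₀(N)`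
exactly `Λ₁`, `δ(T_p y) = T_p δ(y)` for `p ≡ 1 (mod 3)`. The argument: for `x = δ(y)` and an arithmetic Frobenius
`φ` at `p ≡ 1 (mod N)`: `φ x ≡ x`, `φφx ≡ x (mod B)` (fixed-point classes are `ℚ(ζ_N)`-rational) and
`φφx − T_p φx + p x = 0` (Eichler–Shimura), so `(T_p − 1 − p) x ∈ B`, i.e. `(T_p − 2) x ∈ B` (`3x = 0`,
`3 ∣ p − 1`), i.e. `(T_p − 2) y ∈ Λ₁`. THEOREMS + one inline named-fact `def`; no `sorry`. The stub is thereby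
CLOSED MODULO that fact (conditional result); no summit is proved; BSD is NOT proved.
-/

set_option autoImplicit false
-- D-0017: single-problem summit, so `Summit.BirchSwinnertonDyer.BirchSwinnertonDyer.…` repeats a namespace BY DESIGN.
set_option linter.dupNamespace false

noncomputable section

open scoped NumberField
open IsDedekindDomain NumberField Field
open Literature.NumberTheory.EllipticCurves.ModularForms Literature.NumberTheory.ModularSymbols
open Literature.NumberTheory.GaloisRepresentations Rat.HeightOneSpectrum

namespace Summit.BirchSwinnertonDyer.BirchSwinnertonDyer.Theorems.TameQuarticManinParity

section Jacobian

variable {N : ℕ} [NeZero N] (h9 : 3 ^ 2 ∣ N)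

/-- `B = Nm J₀(N)` is `T_p`-stable (`p ≠ 3`): `T_p (Nm z) = Nm (T_p z)`. [cite: DiamondShurman2005, Prop. 5.2.2(a) (derived reading, see `normDual_dualMap_heckeT`)] -/
theorem T_smul_mem_normRange {p : ℕ} (hp : p.Prime) (hp3 : p ≠ 3) {z : J0 N} (hz : z ∈ normRange N h9) :
    HeckeRing0.T N 2 p hp • z ∈ normRange N h9 := by
  haveI : NeZero p := ⟨hp.ne_zero⟩
  obtain ⟨w, rfl⟩ := hz
  obtain ⟨ψ, rfl⟩ := Submodule.Quotient.mk_surjective (periodHomologyHecke N) w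
  refine ⟨Submodule.Quotient.mk (HeckeRing0.T N 2 p hp • ψ), ?_⟩
  rw [jacobianNorm_mk, jacobianNorm_mk, ← Submodule.Quotient.mk_smul]
  congr 1
  change normDual N h9 ((HeckeRing0.toEnd N 2 (HeckeRing0.T N 2 p hp)).dualMap ψ) =
    (HeckeRing0.toEnd N 2 (HeckeRing0.T N 2 p hp)).dualMap (normDual N h9 ψ)
  rw [HeckeRing0.toEnd_T]
  exact normDual_dualMap_heckeT h9 hp hp3 ψ

end Jacobian

/-- **E30 ⟸ the named fact**: `PrymDefectHeckeEisensteinSplit` (stmt-BirchSwinnertonDyer-23597) holds granted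
`nonempty_shiftDatumEichlerShimuraFixedFrobenius`. CONDITIONAL result (the crux's stub `stub_eisensteinSplit`
closed modulo that fact). [cite: DarmonDiamondTaylor1995, Thm. 1.29 (p. 37)] -/
theorem eisensteinSplit_of_shiftDatum (hF : Literature.NumberTheory.EllipticCurves.nonempty_shiftDatumEichlerShimuraFixedFrobenius) :
    Theses.TameQuarticManinParity.PrymDefectHeckeEisensteinSplit := by
  intro N _ h9 p hp hp3 hp1 y hy
  classical
  obtain ⟨ι, A, hA⟩ := hF N h9
  -- the place `v` of `p`, a prime above it and an arithmetic Frobenius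
  obtain ⟨v, hpv⟩ : ∃ v : HeightOneSpectrum (𝓞 ℚ), ((primesEquiv v : Nat.Primes) : ℕ) = p :=
    ⟨primesEquiv.symm ⟨p, hp⟩, by rw [Equiv.apply_symm_apply]⟩
  have hN9 : 9 ∣ N := by simpa using h9
  have hpN : ¬ p ∣ N := by
    have hN1 : 1 < N := by
      have := Nat.le_of_dvd (Nat.pos_of_ne_zero (NeZero.ne N)) hN9
      omega
    have hmod : p % N = 1 := by
      have h : p % N = 1 % N := hp1
      rwa [Nat.mod_eq_of_lt hN1] at h
    intro hdvd
    rcases (Nat.le_of_dvd (Nat.pos_of_ne_zero (NeZero.ne N)) hdvd).lt_or_eq with hlt | heq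
    · rw [Nat.mod_eq_of_lt hlt] at hmod
      exact hp.one_lt.ne' hmod
    · rw [heq, Nat.mod_self] at hmod
      exact zero_ne_one hmod
  have hndvd : ¬ ((primesEquiv v : Nat.Primes) : ℕ) ∣ 3 * N := by
    rw [hpv]
    intro h
    rcases (Nat.Prime.dvd_mul hp).mp h with h3 | hN'
    · exact hp3 ((Nat.prime_dvd_prime_iff_eq hp Nat.prime_three).mp h3)
    · exact hpN hN'
  obtain ⟨𝔓, h𝔓⟩ := v.primesAbove_nonempty
  obtain ⟨φ, hφ⟩ := HeightOneSpectrum.exists_isArithFrobAt_of_mem_primesAbove_holds h𝔓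
  obtain ⟨hES, hFIX⟩ := hA v hndvd 𝔓 h𝔓 φ hφ
  have hp1v : ((primesEquiv v : Nat.Primes) : ℕ) ≡ 1 [MOD N] := by rw [hpv]; exact hp1
  -- `p ≡ 1 (mod 3)`
  have hp13 : p % 3 = 1 := by
    have h3 : p ≡ 1 [MOD 3] := Nat.ModEq.of_dvd (by norm_num : 3 ∣ 9) (Nat.ModEq.of_dvd hN9 hp1)
    exact h3
  have hT : HeckeRing0.T N 2 ((primesEquiv v : Nat.Primes) : ℕ) (primesEquiv v : Nat.Primes).2 =
      HeckeRing0.T N 2 p hp := by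
    have key : ∀ (q : ℕ) (hq : q.Prime), q = p → HeckeRing0.T N 2 q hq = HeckeRing0.T N 2 p hp := by
      rintro q hq rfl; rfl
    exact key _ _ hpv
  -- the torsion point `x = δ(y)`
  obtain ⟨x, hxdef⟩ : ∃ x : J0 N, prymDefectMap N h9 ⟨y, hy⟩ = x := ⟨_, rfl⟩
  have hxtors : x ∈ J0.tors N := by rw [← hxdef]; exact prymDefectMap_mem_tors N h9 ⟨y, hy⟩
  obtain ⟨xt, hxt⟩ : ∃ xt : J0.tors N, (xt : J0 N) = x := ⟨⟨x, hxtors⟩, rfl⟩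
  have hxt_fix : xt ∈ J0.torsFixedByShift N h9 := by
    rw [J0.mem_torsFixedByShift_iff]
    apply Subtype.ext
    rw [J0.coe_shiftTors, hxt, ← hxdef]
    exact shift_prymDefectMap N h9 ⟨y, hy⟩
  have h3x : (3 : ℕ) • x = 0 := by rw [← hxdef]; exact three_nsmul_prymDefectMap N h9 ⟨y, hy⟩
  have h3xt : (3 : HeckeRing0 N 2) • xt = 0 := by
    apply Subtype.ext
    change (((3 : HeckeRing0 N 2) • xt : J0.tors N) : J0 N) = 0
    rw [Submodule.coe_smul, hxt, show (3 : HeckeRing0 N 2) = ((3 : ℕ) : HeckeRing0 N 2) by norm_cast,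
      Nat.cast_smul_eq_nsmul, h3x]
  -- Eichler–Shimura on `xt` and the triviality of `φ` modulo `B`
  obtain ⟨a, hadef⟩ : ∃ a : J0.tors N, A.galAct φ xt = a := ⟨_, rfl⟩
  have hES' := hES xt h3xt
  rw [hT, hpv, hadef] at hES'
  have hFIXx : ((a : J0.tors N) : J0 N) - x ∈ normRange N h9 := by
    rw [← hadef, ← hxt]; exact hFIX hp1v xt hxt_fix
  have ha_fix : a ∈ J0.torsFixedByShift N h9 := by rw [← hadef]; exact A.galAct_mem_torsFixedByShift φ hxt_fix
  have hFIXa : ((A.galAct φ a : J0.tors N) : J0 N) - (a : J0 N) ∈ normRange N h9 := hFIX hp1v a ha_fix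
  -- coerce Eichler–Shimura to `J0 N`: `φ a − T a + p x = 0`
  have hESJ : ((A.galAct φ a : J0.tors N) : J0 N) - HeckeRing0.T N 2 p hp • ((a : J0.tors N) : J0 N)
      + (p : HeckeRing0 N 2) • x = 0 := by
    have h := congrArg (fun z : J0.tors N ↦ (z : J0 N)) hES'
    simpa only [Submodule.coe_add, Submodule.coe_sub, Submodule.coe_smul, Submodule.coe_zero, hxt] using h
  -- `(T_p − 2) x ∈ B`
  have hTx : HeckeRing0.T N 2 p hp • x - (2 : ℕ) • x ∈ normRange N h9 := by
    have hTa : HeckeRing0.T N 2 p hp • ((a : J0.tors N) : J0 N) =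
        ((A.galAct φ a : J0.tors N) : J0 N) + (p : HeckeRing0 N 2) • x := by
      rw [← sub_eq_zero]
      have e : HeckeRing0.T N 2 p hp • ((a : J0.tors N) : J0 N) -
          (((A.galAct φ a : J0.tors N) : J0 N) + (p : HeckeRing0 N 2) • x) =
          -(((A.galAct φ a : J0.tors N) : J0 N) - HeckeRing0.T N 2 p hp • ((a : J0.tors N) : J0 N)
            + (p : HeckeRing0 N 2) • x) := by abel
      rw [e, hESJ, neg_zero]
    have hpx : (p : HeckeRing0 N 2) • x = x := by
      obtain ⟨k, hk⟩ : ∃ k, p = k * 3 + 1 := ⟨p / 3, by omega⟩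
      rw [show (p : HeckeRing0 N 2) = ((p : ℕ) : HeckeRing0 N 2) from rfl, Nat.cast_smul_eq_nsmul, hk,
        add_smul, one_smul, mul_nsmul', h3x, nsmul_zero, zero_add]
    have e : HeckeRing0.T N 2 p hp • x - (2 : ℕ) • x =
        (((A.galAct φ a : J0.tors N) : J0 N) - (a : J0 N)) + (((a : J0.tors N) : J0 N) - x)
          - HeckeRing0.T N 2 p hp • (((a : J0.tors N) : J0 N) - x) := by
      rw [smul_sub, hTa, hpx, two_nsmul]
      abel
    rw [e]
    exact AddSubgroup.sub_mem _ (AddSubgroup.add_mem _ hFIXa hFIXx) (T_smul_mem_normRange h9 hp hp3 hFIXx)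
  -- back to the lattice through `δ`
  have hTy : HeckeRing0.T N 2 p hp • y ∈ prymLattice N h9 := T_smul_mem_prymLattice h9 hp hp3 hy
  have h2 : (2 : HeckeRing0 N 2) • y = (2 : ℕ) • y := by
    rw [show (2 : HeckeRing0 N 2) = ((2 : ℕ) : HeckeRing0 N 2) by norm_cast, Nat.cast_smul_eq_nsmul]
  have hmem : HeckeRing0.T N 2 p hp • y - (2 : ℕ) • y ∈ prymLattice N h9 :=
    Submodule.sub_mem _ hTy (Submodule.smul_of_tower_mem _ (2 : ℕ) hy)
  have hsplit : (⟨_, hmem⟩ : prymLattice N h9) = ⟨_, hTy⟩ - (2 : ℕ) • ⟨y, hy⟩ := rfl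
  have hδT : prymDefectMap N h9 ⟨_, hTy⟩ = HeckeRing0.T N 2 p hp • x := by
    rw [← hxdef]
    exact prymDefectMap_T_smul_of_mod_three_eq_one h9 hp hp3 hp13 ⟨y, hy⟩
  have hδ : prymDefectMap N h9 ⟨_, hmem⟩ = HeckeRing0.T N 2 p hp • x - (2 : ℕ) • x := by
    rw [hsplit, map_sub, map_nsmul, hδT, hxdef]
  have hB : prymDefectMap N h9 ⟨_, hmem⟩ ∈ normRange N h9 := by
    rw [hδ]
    exact hTx
  have hΛ : HeckeRing0.T N 2 p hp • y - (2 : ℕ) • y ∈ shiftSubOneLattice N h9 :=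
    (prymDefectMap_mem_normRange_iff N h9 ⟨_, hmem⟩).mp hB
  rw [sub_smul (HeckeRing0.T N 2 p hp) (2 : HeckeRing0 N 2) y, h2]
  exact hΛ

end Summit.BirchSwinnertonDyer.BirchSwinnertonDyer.Theorems.TameQuarticManinParity

end
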